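import Summits.BirchSwinnertonDyer.BirchSwinnertonDyer.Theorems.PrintCf2RubinValueTwoClassGroupHalfOfPrint
import HarnessLib

/-!
# Brick (a) in the CRUX CONVENTION, part IV: the `θ = 1` class-group input with `K₀ = H = rayClassField K ⊤` (the Hilbert class field as the tree's
# CFT object, with its own `FiniteDimensional` / `IsAbelianGalois` / `NumberField` instances) — the form the (b)-assembler
# `LeopoldtAtV.exists_unitIndexData₂_rubinLayer (hH : rayClassField K ⊤ ≤ K₀)` is fed with

Cell `bsd-print-cf2`, width seat `bsd-line-cf2c-w8` g6 (prover-bsd-line-cf2c-w8-g6-0); companion of `…ClassGroupHalfOfPrint` (§3 there has `K₀ = ⊥`). For ANY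
`p ∤ h_K`: the §5.4 setting of [JohnsonLeungKings2011] holds with `K₀ = rayClassField K ⊤` for every `θ` trivial on `Gal(K̄/H)` and every pinned pair fixing
`H` (`isSec54Setting_rayClassField_top`; `[H : K] = h_K`, tree `hilbertClassField.finrank_eq_classNumber`); on a class-number-one `K` (`H = ⊥`, DA7: `discr K = −7`)
every `σ` fixes `H`, whence **`sec54_charIdeal_eq_inv_of_trivialChar_rayClassField` / `…_of_discr_eq_neg_seven_rayClassField`**: granted the §5.4 named fact,
for `θ ≡ 1`, every `C : ClassGroupDualData₂ κ₁ κ₂ θ γ₁⁻¹ γ₂⁻¹` and `E : UnitIndexData₂ ι (rayClassField K ⊤) κ₁ κ₂ θ γ₁⁻¹ γ₂⁻¹`: f.g., torsion,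
`char C.X = char E.Q`, and the socket shape `∃ i i', char C.X·(p)^i = char E.Q·(p)^{i'}` — at EVERY `p`, so at `p = 2` (the (Q_T) input `ha`).
CONDITIONAL on the displayed named fact only; THEOREMS ONLY; Theses-free; no `def`, no new fact, no `sorry`. No summit statement is proved by this seat;
BSD is not proved by any of this. beyond-print theorem: no.

References: [JohnsonLeungKings2011] §5.4 (arXiv:0804.2828 p0016:L19–26); [NeukirchANT1999] VI (6.9); [Cox2013] Thm. 7.7(ii).
-/

noncomputable section

open scoped Classical
-- the summit namespace `Summit.BirchSwinnertonDyer.BirchSwinnertonDyer` repeats the problem name by design (D-0017)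
set_option linter.dupNamespace false
set_option autoImplicit false
open NumberField IsDedekindDomain Field
open Literature.NumberTheory.GaloisRepresentations Literature.NumberTheory.EllipticCurves
  Literature.NumberTheory.EllipticCurves.KellerYin2024 Literature.NumberTheory.ComplexMultiplication.EllipticUnits
  Literature.NumberTheory.NumberFields

/-! ## `K₀ = H = rayClassField K ⊤` for characters of `Gal(H/K)` — the general form (any `p ∤ h_K`) -/

namespace Summit.BirchSwinnertonDyer.BirchSwinnertonDyer.Theorems.PrintCf2.ClassGroupHalf

variable {K : Type} [Field K] [NumberField K] {p : ℕ} [Fact p.Prime]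
  {κ₁ κ₂ : ZpExtension K p} {γ₁ γ₂ : absoluteGaloisGroup K} {θ : FramedGaloisRep K (padicCoeffIntegers (∅ : Set (PadicAlgCl p))) 1}

/-- **`p ∤ h_K ⟹` the §5.4 setting holds with `K₀ = H` (the Hilbert class field, as `rayClassField K ⊤`) for every `θ` trivial on `Gal(K̄/H)` and every
pinned pair fixing `H` pointwise** (`[H : K] = h_K`, Neukirch VI (6.9); `H/K` finite abelian — tree instances of `rayClassField`).
[cite: JohnsonLeungKings2011, §5.4 (arXiv p0016:L26)] [cite: NeukirchANT1999, Ch. VI §6 Prop. (6.9)] -/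
theorem isSec54Setting_rayClassField_top (hK : IsImaginaryQuadratic K) (hh : ¬ p ∣ NumberField.classNumber K)
    (hpair : ZpExtension.IsTopGeneratorPair κ₁ κ₂ γ₁ γ₂)
    (hγ₁ : ∀ x : AlgebraicClosure K, x ∈ rayClassField K (⊤ : Ideal (𝓞 K)) → γ₁ • x = x)
    (hγ₂ : ∀ x : AlgebraicClosure K, x ∈ rayClassField K (⊤ : Ideal (𝓞 K)) → γ₂ • x = x)
    (hθ : ∀ σ : absoluteGaloisGroup K, (∀ x : AlgebraicClosure K, x ∈ rayClassField K (⊤ : Ideal (𝓞 K)) → σ • x = x) → θ σ = 1) :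
    JohnsonLeungKings2011.IsSec54Setting (rayClassField K (⊤ : Ideal (𝓞 K))) κ₁ κ₂ γ₁ γ₂ θ where
  isImaginaryQuadratic := hK
  hilbert_le := le_rfl
  finiteDimensional := inferInstance
  isGalois := inferInstance
  comm := fun σ τ ↦ IsMulCommutative.is_comm.comm σ τ
  not_dvd_finrank := by
    rwa [hilbertClassField.rayClassField_top_eq_hilbertClassField K, hilbertClassField.finrank_eq_classNumber K]
  pair := hpair
  smul_eq₁ := hγ₁
  smul_eq₂ := hγ₂
  theta_eq_one := hθ

/-- On a class-number-one field `H = K`: every `σ` fixes `rayClassField K ⊤` pointwise. [cite: NeukirchANT1999, Ch. VI §6 Prop. (6.9)] -/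
theorem smul_eq_self_of_mem_rayClassField_top (h1 : NumberField.classNumber K = 1) (σ : absoluteGaloisGroup K) (x : AlgebraicClosure K)
    (hx : x ∈ rayClassField K (⊤ : Ideal (𝓞 K))) : σ • x = x := by
  rw [hilbertClassField.rayClassField_top_eq_hilbertClassField K, (hilbertClassField.eq_bot_iff_card_classGroup_eq_one K).mpr h1] at hx
  exact smul_eq_self_of_mem_bot σ x hx

variable (ι : K →+* ℂ)

/-- **THE CLASS-GROUP INPUT OF (Q_T) AT `θ = 1` WITH `K₀ = rayClassField K ⊤`** (the Hilbert class field as the tree's CFT object, carrying its own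
`FiniteDimensional`/`IsAbelianGalois`/`NumberField` instances — the form cf2c-w5's `exists_unitIndexData₂_rubinLayer (hH : rayClassField K ⊤ ≤ K₀)` is fed
with), on a class-number-one `K` at EVERY `p`: f.g., torsion, `char C.X = char E.Q` and the socket shape, for `C` and `E` at `(γ₁⁻¹, γ₂⁻¹)`.
[cite: JohnsonLeungKings2011, §5.4 (arXiv p0016:L19–26)] [cite: NeukirchANT1999, Ch. VI §6 Prop. (6.9)] -/
theorem sec54_charIdeal_eq_inv_of_trivialChar_rayClassField (h54 : JohnsonLeungKings2011.sec54_charIdeal_classGroup_eq_unitIndex)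
    (hK : IsImaginaryQuadratic K) (h1 : NumberField.classNumber K = 1) (hpair : ZpExtension.IsTopGeneratorPair κ₁ κ₂ γ₁ γ₂)
    (hθ : ∀ σ : absoluteGaloisGroup K, θ σ = 1) (C : ClassGroupDualData₂ κ₁ κ₂ θ γ₁⁻¹ γ₂⁻¹)
    (E : UnitIndexData₂ ι (rayClassField K (⊤ : Ideal (𝓞 K))) κ₁ κ₂ θ γ₁⁻¹ γ₂⁻¹) :
    Module.Finite (IwasawaAlgebra₂ p) C.X ∧ Module.IsTorsion (IwasawaAlgebra₂ p) C.X ∧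
      Module.Finite (IwasawaAlgebra₂ p) E.Q ∧ Module.IsTorsion (IwasawaAlgebra₂ p) E.Q ∧
      Module.charIdeal (IwasawaAlgebra₂ p) C.X = Module.charIdeal (IwasawaAlgebra₂ p) E.Q ∧
      ∃ i i' : ℕ, Module.charIdeal (IwasawaAlgebra₂ p) C.X * Ideal.span {((p : ℕ) : IwasawaAlgebra₂ p)} ^ i =
        Module.charIdeal (IwasawaAlgebra₂ p) E.Q * Ideal.span {((p : ℕ) : IwasawaAlgebra₂ p)} ^ i' := by
  have hh : ¬ p ∣ NumberField.classNumber K := by rw [h1, Nat.dvd_one]; exact (Fact.out : p.Prime).one_lt.ne'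
  obtain ⟨h1', h2, h3, h4, h5⟩ := sec54_charIdeal_eq_inv ι h54
    (isSec54Setting_rayClassField_top hK hh hpair (smul_eq_self_of_mem_rayClassField_top h1 γ₁)
      (smul_eq_self_of_mem_rayClassField_top h1 γ₂) (fun σ _ ↦ hθ σ)) C E
  exact ⟨h1', h2, h3, h4, h5, exists_mul_span_pow_eq_of_eq h5 _⟩

/-- **The same in the binders of `m_line_pin`** (`discr K = −7`). [cite: JohnsonLeungKings2011, §5.4 (arXiv p0016:L19–26)] [cite: Cox2013, §7.B Thm. 7.7(ii)] -/
theorem sec54_charIdeal_eq_inv_of_discr_eq_neg_seven_rayClassField (h54 : JohnsonLeungKings2011.sec54_charIdeal_classGroup_eq_unitIndex)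
    (hK : IsImaginaryQuadratic K) (hdK : NumberField.discr K = -7) (hpair : ZpExtension.IsTopGeneratorPair κ₁ κ₂ γ₁ γ₂)
    (hθ : ∀ σ : absoluteGaloisGroup K, θ σ = 1) (C : ClassGroupDualData₂ κ₁ κ₂ θ γ₁⁻¹ γ₂⁻¹)
    (E : UnitIndexData₂ ι (rayClassField K (⊤ : Ideal (𝓞 K))) κ₁ κ₂ θ γ₁⁻¹ γ₂⁻¹) :
    Module.Finite (IwasawaAlgebra₂ p) C.X ∧ Module.IsTorsion (IwasawaAlgebra₂ p) C.X ∧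
      Module.Finite (IwasawaAlgebra₂ p) E.Q ∧ Module.IsTorsion (IwasawaAlgebra₂ p) E.Q ∧
      Module.charIdeal (IwasawaAlgebra₂ p) C.X = Module.charIdeal (IwasawaAlgebra₂ p) E.Q ∧
      ∃ i i' : ℕ, Module.charIdeal (IwasawaAlgebra₂ p) C.X * Ideal.span {((p : ℕ) : IwasawaAlgebra₂ p)} ^ i =
        Module.charIdeal (IwasawaAlgebra₂ p) E.Q * Ideal.span {((p : ℕ) : IwasawaAlgebra₂ p)} ^ i' :=
  sec54_charIdeal_eq_inv_of_trivialChar_rayClassField ι h54 hK (classNumber_eq_one_of_discr_eq_neg_seven hK hdK) hpair hθ C E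

end Summit.BirchSwinnertonDyer.BirchSwinnertonDyer.Theorems.PrintCf2.ClassGroupHalf

end
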